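import Summits.NavierStokesRegularity.NavierStokesRegularity.Theses.CoreLogGas
import Summits.NavierStokesRegularity.NavierStokesRegularity.Cruxes.BlowupIsLocallyDriven.RestatementC4

/-!
# Evidence C5 — crux A `CoreLogGas.LocallyDrivenIsTypeI` (stmt-NavierStokesRegularity-11290), lead c5, 2026-08-17

Kernel-checked bookkeeping behind the c5 outcome `blocked-on: stmt-NavierStokesRegularity-0056` (report
`Lines/registered-dead-c5.md`). NOT a proof of A; nothing here is proposed to `Theorems/`.

* `A_of_noTypeII` — the crux A as typed is the shared target `NoTypeII` (stmt-NavierStokesRegularity-0056, the very decl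
  `Theses.CoreLogGas.NoTypeII` of this route file) WEAKENED by the locality hypothesis `H`; the implication is one line.
* `A_rate2_of_noTypeII`, `A_rate2_xi_of_noTypeII` — the same holds verbatim for BOTH re-typings of A proposed by the B-side
  lead c4 (`Cruxes/BlowupIsLocallyDriven/RestatementC4.lean`: scale-free modulus `C/M²·Ω(t) + g`, all `M ≥ 1`; and its
  stretching-direction variant). So the planner's pending restatement does not change A's position: every typing of A on
  the table is a weakening of stmt-0056 for which five leads (c1–c5) and nine refuter passes found no engine other than
  stmt-0056 itself (direction obstruction `EvidenceC3.lower_rate_of_upper_growth`; engine census c4 §3).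
* `A_of_noBlowup` — and A is implied by the continuation statement (hypothesis of `NoBlowupToClay`, = stmt-0054) by vacuity.
* `noTypeII_of_A_B` / `route_pair_iff_noBlowup` — conversely A ∧ B gives `NoTypeII`, and modulo the shared
  `NoTypeIBlowup` (stmt-1217) the PAIR (A, B) is equivalent to the continuation statement: the A/B cut re-partitions
  NoBlowup, it does not sit below it.

`lean check`: rc 0, 0 sorries, 0 warnings; axioms of every theorem ⊆ {propext, Classical.choice, Quot.sound}.
-/

-- justification: scratch namespace under the crux's Cruxes/ path (evidence file, not proposed).
set_option linter.dupNamespace false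

namespace Summit.NavierStokesRegularity.NavierStokesRegularity.Cruxes.LocallyDrivenIsTypeI.EvidenceC5

open Summit.NavierStokesRegularity.NavierStokesRegularity.Theses.CoreLogGas
open Summit.NavierStokesRegularity.NavierStokesRegularity.Cruxes.BlowupIsLocallyDriven.RestatementC4

/-- The continuation statement for Clay data (the hypothesis of `NoBlowupToClay`; = shared item stmt-0054 `NoBlowup`). -/
def NoBlowupSig : Prop :=
  ∀ (ν T : ℝ), 0 < ν → 0 < T →
    ∀ (u : ℝ → EuclideanSpace ℝ (Fin 3) → EuclideanSpace ℝ (Fin 3)) (p : ℝ → EuclideanSpace ℝ (Fin 3) → ℝ),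
      Literature.Analysis.FluidPDE.IsClassicalNSSolutionOn (Set.Ico 0 T) ν 0 u p →
      Literature.Analysis.FluidPDE.IsLerayHopfOn T ν 0 (u 0) u →
      Literature.Analysis.FluidPDE.HasRapidSpatialDecay (u 0) →
      Literature.Analysis.FluidPDE.HasSmoothExtensionPast ν 0 u T

/-- **A ⇐ NoTypeII.** The crux A as typed is the shared target stmt-0056 weakened by the locality hypothesis. -/
theorem A_of_noTypeII (h : NoTypeII) : LocallyDrivenIsTypeI :=
  fun ν T hν hT u p hmax hlh hdec _ => h ν T hν hT u p hmax hlh hdec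

/-- **A′ ⇐ NoTypeII** for the B-lead's re-typing `A_rate2` (scale-free modulus `C/M²·Ω(t)+g`, all `M ≥ 1`). -/
theorem A_rate2_of_noTypeII (h : NoTypeII) : A_rate2 :=
  fun ν T hν hT u p hmax hlh hdec _ => h ν T hν hT u p hmax hlh hdec

/-- **A′_ξ ⇐ NoTypeII** for the stretching-direction re-typing `A_rate2_xi`. -/
theorem A_rate2_xi_of_noTypeII (h : NoTypeII) : A_rate2_xi :=
  fun ν T hν hT u p hmax hlh hdec _ => h ν T hν hT u p hmax hlh hdec

/-- **A ⇐ NoBlowup** (vacuity: under the continuation statement there is no maximal solution at all). -/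
theorem A_of_noBlowup (h : NoBlowupSig) : LocallyDrivenIsTypeI :=
  fun ν T hν hT u p hmax hlh hdec _ => (hmax.2 (h ν T hν hT u p hmax.1 hlh hdec)).elim

/-- **A ∧ B ⇒ NoTypeII** (the route's own composition, for the record). -/
theorem noTypeII_of_A_B (hA : LocallyDrivenIsTypeI) (hB : BlowupIsLocallyDriven) : NoTypeII :=
  fun ν T hν hT u p hmax hlh hdec => hA ν T hν hT u p hmax hlh hdec (hB ν T hν hT u p hmax hlh hdec)

/-- **Modulo the shared `NoTypeIBlowup` (stmt-1217), the pair (A, B) is EQUIVALENT to the continuation statement.**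
The A/B cut re-partitions NoBlowup; it is not below it. -/
theorem route_pair_iff_noBlowup (hI : NoTypeIBlowup) :
    (LocallyDrivenIsTypeI ∧ BlowupIsLocallyDriven) ↔ NoBlowupSig := by
  constructor
  · rintro ⟨hA, hB⟩ ν T hν hT u p hcl hlh hdec
    by_contra hext
    exact hext (hI ν T hν hT u p hcl hlh hdec
      (noTypeII_of_A_B hA hB ν T hν hT u p ⟨hcl, hext⟩ hlh hdec))
  · intro h
    exact ⟨A_of_noBlowup h,
      fun ν T hν hT u p hmax hlh hdec => (hmax.2 (h ν T hν hT u p hmax.1 hlh hdec)).elim⟩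

/-- The same equivalence for the re-typed pair (A′, B′) of `RestatementC4`. -/
theorem route_pair_rate2_iff_noBlowup (hI : NoTypeIBlowup) :
    (A_rate2 ∧ B_rate2) ↔ NoBlowupSig := by
  constructor
  · rintro ⟨hA, hB⟩ ν T hν hT u p hcl hlh hdec
    by_contra hext
    exact hext (hI ν T hν hT u p hcl hlh hdec
      (hA ν T hν hT u p ⟨hcl, hext⟩ hlh hdec (hB ν T hν hT u p ⟨hcl, hext⟩ hlh hdec)))
  · intro h
    exact ⟨fun ν T hν hT u p hmax hlh hdec _ => (hmax.2 (h ν T hν hT u p hmax.1 hlh hdec)).elim,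
      fun ν T hν hT u p hmax hlh hdec => (hmax.2 (h ν T hν hT u p hmax.1 hlh hdec)).elim⟩

end Summit.NavierStokesRegularity.NavierStokesRegularity.Cruxes.LocallyDrivenIsTypeI.EvidenceC5
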